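import Summits.BirchSwinnertonDyer.BirchSwinnertonDyer.Theses.UniversalToricDescent
import Summits.BirchSwinnertonDyer.BirchSwinnertonDyer.Theorems.UniversalToricDescentToricTransportModThreeStubRatSqueeze
import Summits.BirchSwinnertonDyer.BirchSwinnertonDyer.Theorems.UniversalToricDescentRationalSplitIMCInclusionAtThreeOfWall
import Literature.NumberTheory.EllipticCurves.QuadraticTwist
import Mathlib.RingTheory.PowerSeries.Ideal
import Mathlib.NumberTheory.LegendreSymbol.JacobiSymbol
import Mathlib.Tactic.NormNum.LegendreSymbol
import HarnessLib

/-!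
# Node `quadratic_unfolding_partner` — crux `AdditiveSplitIMCInclusionAtThree` (stmt-BirchSwinnertonDyer-20395)

cruxidea g23 (2026-08-31). LEVER (one sentence): base-change `E` to a REAL quadratic field `F = ℚ(√D)` in which
`3` is INERT — the inducing field of the supercuspidal `π₃ = Ind θ` becomes the completion `F_v = ℚ₉`, so
`BC_{F_v}(π₃) = π(θ, θ^σ)` is PRINCIPAL SERIES (Jacquet module ≠ 0, `U_v`-eigenvectors of slope `½` exist,
`ρ_E|_{G_{ℚ₉}} ≅ η ⊕ η^σ` "fake CM") — accept the parity price (`sign(E/KF) = +1`: over `K` the objects of `E/KF`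
are those of the PAIR `E × E^D`), and cancel the PARTNER `E^D` not by splitting a product divisibility but by the
ANALYTIC `μ = 0` of its BDP branch: `μ(g_E) ≤ μ(g_E g_{E^D}) ≤ μ(L_E L_{E^D}) = μ(L_E) + 0`.

WHAT IS KERNEL-CHECKED HERE (no `sorry` outside `stub_*`):
* `muDominance_of_partner` : `TwinProductMuDominanceAtThree → TwinAnalyticMuZeroAtThree → MuDominanceAtThree`
  (prime-power cancellation in the domain `R₀⟦T⟧`, `Prime.pow_dvd_of_dvd_mul_right`, plus the partner plumbing);
* `AdditiveSplitIMCInclusionAtThree_of` : RATWALL (24207, BY NAME) → the two partner pieces → THE CRUX BY NAME,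
  through the g7 door (WALL ⟸ RATWALL ∧ μ-dominance; §0 and `wall_of_ratwall_of_muDominance` are VERBATIM the
  kernel of node `Lines/mu_dominance_relative_teeth.lean`, inlined so that this file builds from `Theses` +
  `Theorems` alone — the farm does not build `Cruxes/…/Lines` modules as dependencies).

PIECE TAGS (D-0171): `stub_ratwall` WEAKER (landed `ratwall_of_wall`); `stub_twinProductMuDominance` UNDECIDED
(neither direction to the crux is formal: it concerns the pair `(E, E^D)` for every unfolding `D`; morally it is
implied by μ-dominance for `E` and for `E^D` separately, and it implies μ-dominance for `E` only together with the
analytic piece); `stub_twinAnalyticMuZero` UNDECIDED/ATTACKABLE (Hsieh-type `μ = 0`, a literature port with one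
check: the additive level `3² ∣ N D²`). LEAVES: see `Lines/quadratic_unfolding_partner.md`.

The partner model `W.quadraticTwist D` is the tree's (generally non-minimal) twist model
(`Literature.NumberTheory.EllipticCurves.QuadraticTwist`); nothing below needs minimality of the partner: its
Selmer dual `X_(∅,0)` and its BDP branch are read through the same tree predicates as the crux's, at the SAME
`(K, κ, γ, 𝔭, 𝔭', ι')`.
-/

set_option linter.dupNamespace false
set_option autoImplicit false

noncomputable section

open scoped Classical

open Literature.NumberTheory.EllipticCurves
open Summit.BirchSwinnertonDyer.BirchSwinnertonDyer.Theses.UniversalToricDescent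
open Summit.BirchSwinnertonDyer.BirchSwinnertonDyer.Cruxes.ToricTransportModThree.RatwallThinComb
open Summit.BirchSwinnertonDyer.BirchSwinnertonDyer.Theorems.UniversalToricDescentRationalSplitIMCInclusionAtThreeOfWall
open Summit.BirchSwinnertonDyer.Rank1Residual.X11b

namespace Summit.BirchSwinnertonDyer.BirchSwinnertonDyer.Cruxes.AdditiveSplitIMCInclusionAtThree.QuadraticUnfoldingPartner

/-! ## §0 Kernel algebra in `R₀⟦T⟧` and the g7 door (VERBATIM node `mu_dominance_relative_teeth`, no `sorry`) -/

/-- Every non-zero `g ∈ R₀⟦T⟧` splits off a MAXIMAL power of the prime `3`: `g = 3^μ·g₀` with `3 ∤ g₀`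
(`R₀` is a DVR, so `R₀⟦T⟧` is a UFD; `WfDvdMonoid.max_power_factor`). [Washington1997 §7.1] -/
theorem exists_eq_C_three_pow_mul_not_dvd {g : UnrSeries 3} (hg : g ≠ 0) :
    ∃ (μ : ℕ) (g₀ : UnrSeries 3),
      ¬ (PowerSeries.C ((3 : ℕ) : unrIntegers 3) : UnrSeries 3) ∣ g₀ ∧
        g = (PowerSeries.C ((3 : ℕ) : unrIntegers 3)) ^ μ * g₀ := by
  haveI := Summit.BirchSwinnertonDyer.Rank1Residual.X2.HidaLimitAlgebra.isDiscreteValuationRing_unrIntegers (p := 3)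
  exact WfDvdMonoid.max_power_factor hg prime_C_three.irreducible

/-- **The 3-saturation kernel of the wall** (g7): `g ∣ 3^k·L` and μ-dominance of `g` by `L` give `(L) ⊆ (g)`.
[folklore; Washington1997 §7.1] -/
theorem span_le_span_of_dvd_pow_mul_of_muDominance {g L : UnrSeries 3} {k : ℕ}
    (hk : g ∣ (PowerSeries.C ((3 : ℕ) : unrIntegers 3)) ^ k * L)
    (hμ : ∀ j : ℕ, (PowerSeries.C ((3 : ℕ) : unrIntegers 3)) ^ j ∣ g →
      (PowerSeries.C ((3 : ℕ) : unrIntegers 3)) ^ j ∣ L) :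
    Ideal.span ({L} : Set (UnrSeries 3)) ≤ Ideal.span {g} := by
  refine Ideal.span_singleton_le_span_singleton.mpr ?_
  by_cases hg : g = 0
  · subst hg
    obtain ⟨c, hc⟩ := hk
    rw [zero_mul] at hc
    rcases mul_eq_zero.mp hc with h3 | hL
    · exact absurd (pow_eq_zero_iff'.mp h3).1 prime_C_three.ne_zero
    · rw [hL]
  · obtain ⟨μ, g₀, hg₀, rfl⟩ := exists_eq_C_three_pow_mul_not_dvd hg
    obtain ⟨L₀, rfl⟩ := hμ μ (Dvd.intro g₀ rfl)
    refine mul_dvd_mul_left _ (dvd_of_dvd_prime_pow_mul prime_C_three hg₀ k ?_)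
    have h' : (PowerSeries.C ((3 : ℕ) : unrIntegers 3)) ^ μ * g₀ ∣
        (PowerSeries.C ((3 : ℕ) : unrIntegers 3)) ^ μ * ((PowerSeries.C ((3 : ℕ) : unrIntegers 3)) ^ k * L₀) := by
      have e : (PowerSeries.C ((3 : ℕ) : unrIntegers 3)) ^ k * ((PowerSeries.C ((3 : ℕ) : unrIntegers 3)) ^ μ * L₀)
          = (PowerSeries.C ((3 : ℕ) : unrIntegers 3)) ^ μ * ((PowerSeries.C ((3 : ℕ) : unrIntegers 3)) ^ k * L₀) := by
        ring
      rw [← e]; exact hk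
    exact (mul_dvd_mul_iff_left (pow_ne_zero μ prime_C_three.ne_zero)).mp h'

/-- `Ch_Λ(X)·R₀⟦T⟧` is principal for every `Λ`-module (tree `charIdeal_isPrincipal_holds`, `Ideal.map_span`).
[Washington1997 §13.2] -/
theorem exists_map_charIdeal_eq_span (M : Type) [AddCommGroup M] [Module (IwasawaAlgebra 3) M] :
    ∃ g : UnrSeries 3,
      (Module.charIdeal (IwasawaAlgebra 3) M).map (PowerSeries.map (Halves.toUnr 3)) = Ideal.span {g} := by
  obtain ⟨f, hf⟩ := (charIdeal_isPrincipal_holds 3 M).principal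
  refine ⟨PowerSeries.map (Halves.toUnr 3) f, ?_⟩
  have hf' : Module.charIdeal (IwasawaAlgebra 3) M = Ideal.span {f} := hf
  rw [hf', Ideal.map_span, Set.image_singleton]

/-- g7 PIECE A (VERBATIM `MuDominanceRelativeTeeth.MuDominanceAtThree`, same normalised signature): μ-DOMINANCE at
additive split 3 — at every wall frame and every generator `g` of `Ch_Λ(X_(∅,0)(E/K_∞))·R₀⟦T⟧`, each power of `3`
dividing `g` divides the BDP branch `L`. WEAKER than the crux; jointly with RATWALL equivalent to it (g7).
[Howard2004HeegnerKolyvagin Thm. 2.2.10 shape; Washington1997 §13.2] -/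
def MuDominanceAtThree : Prop :=
  ∀ (W : WeierstrassCurve ℚ) [W.IsElliptic] [W.IsGloballyMinimal] (N : ℕ) [NeZero N] (K : Type) [Field K]
    [NumberField K] (Dt : ModularForms.ModularParametrizationData W N),
    Summit.BirchSwinnertonDyer.Rank1Residual.Additive.ClassO6 W 3 → W.HasSurjectiveModNGaloisRep 3 →
    W.analyticRank = 1 → W.conductorNorm ℤ = N → IsImaginaryQuadratic K → SatisfiesHeegnerHypothesis N K →
    ∀ (κ : ZpExtension K 3), κ.IsAnticyclotomic →
    ∀ (γ : Field.absoluteGaloisGroup K) [Fact (κ.IsTopGenerator γ)]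
      (𝔭 : IsDedekindDomain.HeightOneSpectrum (NumberField.RingOfIntegers K)),
      ((3 : ℕ) : NumberField.RingOfIntegers K) ∈ 𝔭.asIdeal →
      𝔭.asIdeal.ramificationIdx (NumberField.RingOfIntegers ℚ) = 1 →
      𝔭.asIdeal.inertiaDeg (NumberField.RingOfIntegers ℚ) = 1 →
      ∀ (𝔭' : IsDedekindDomain.HeightOneSpectrum (NumberField.RingOfIntegers K)),
        ((3 : ℕ) : NumberField.RingOfIntegers K) ∈ 𝔭'.asIdeal → 𝔭' ≠ 𝔭 →
        ∀ (ι' : PadicAlgCl 3 ≃+* ℂ),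
          Summit.BirchSwinnertonDyer.BirchSwinnertonDyer.Theorems.SchneiderFree.BranchInducesPrime 3 ι' 𝔭 →
          ∀ (ΩK : ℂ) (Ωp : ℂ_[3]) (L : UnrSeries 3), ΩK ≠ 0 → Ωp ≠ 0 →
            IsBDPLFunction ι' 𝔭 κ γ Dt.f ΩK Ωp L →
            ∀ g : UnrSeries 3,
              (AcSelmer.XAc.charIdeal (W.baseChange K) 3 κ 𝔭' ∅ γ).map (PowerSeries.map (Halves.toUnr 3)) =
                  Ideal.span {g} →
              ∀ j : ℕ, (PowerSeries.C ((3 : ℕ) : unrIntegers 3)) ^ j ∣ g →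
                (PowerSeries.C ((3 : ℕ) : unrIntegers 3)) ^ j ∣ L

/-- **g7 DOOR (VERBATIM): THE WALL from the rational wall and μ-dominance** — concludes the crux BY NAME.
[folklore; Washington1997 §7.1] -/
theorem wall_of_ratwall_of_muDominance :
    RationalSplitIMCInclusionAtThree → MuDominanceAtThree → AdditiveSplitIMCInclusionAtThree := by
  intro hR hM W _ _ N _ K _ _ Dt hO6 hsurj hr1 hN hK hH κ hκ γ _ 𝔭 h3 he hf 𝔭' h3' hne ι' hι ΩK Ωp L hΩK hΩp hL
  obtain ⟨k, hk⟩ := hR W N K Dt hO6 hsurj hr1 hN hK hH κ hκ γ 𝔭 h3 he hf 𝔭' h3' hne ι' hι ΩK Ωp L hΩK hΩp hL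
  obtain ⟨g, hg⟩ := exists_map_charIdeal_eq_span (AcSelmer.XAc (W.baseChange K) 3 κ 𝔭' ∅ γ)
  have hg' : (AcSelmer.XAc.charIdeal (W.baseChange K) 3 κ 𝔭' ∅ γ).map (PowerSeries.map (Halves.toUnr 3)) =
      Ideal.span {g} := hg
  have hμ := hM W N K Dt hO6 hsurj hr1 hN hK hH κ hκ γ 𝔭 h3 he hf 𝔭' h3' hne ι' hι ΩK Ωp L hΩK hΩp hL g hg'
  rw [hg'] at hk ⊢
  have hdvd : g ∣ ((3 : ℕ) : UnrSeries 3) ^ k * L := Ideal.mem_span_singleton.mp hk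
  rw [← map_natCast (PowerSeries.C (R := unrIntegers 3))] at hdvd
  exact span_le_span_of_dvd_pow_mul_of_muDominance hdvd hμ

/-- Tag WEAKER for g7 piece A (VERBATIM): THE WALL ⟹ μ-DOMINANCE. -/
theorem muDominance_of_wall : AdditiveSplitIMCInclusionAtThree → MuDominanceAtThree := by
  intro hW W _ _ N _ K _ _ Dt hO6 hsurj hr1 hN hK hH κ hκ γ _ 𝔭 h3 he hf 𝔭' h3' hne ι' hι ΩK Ωp L hΩK hΩp hL g hg j hj
  have h := hW W N K Dt hO6 hsurj hr1 hN hK hH κ hκ γ 𝔭 h3 he hf 𝔭' h3' hne ι' hι ΩK Ωp L hΩK hΩp hL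
  rw [hg] at h
  exact hj.trans (Ideal.span_singleton_le_span_singleton.mp h)

/-! ## §0b The unfolding discriminants -/

/-- `D` is an UNFOLDING DISCRIMINANT at `3`: `D > 1` squarefree and `(D/3) ≠ 1`, i.e. `3` does NOT split in the real
quadratic field `F = ℚ(√D)` — it is INERT (`D ≡ 2 mod 3`, `F_v = ℚ₉` = the inducing field of an unramified supercuspidal
`π₃`, class SCu) or RAMIFIED (`3 ∣ D`, `F_v` a ramified quadratic extension of `ℚ₃` = the inducing field of a ramified
supercuspidal, class SCr, when it matches). Over such `F_v` a dihedral `π₃ = Ind_{W_{F_v}} θ` unfolds: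
`BC_{F_v}(π₃) = π(θ, θ^σ)` is principal series. [Langlands 1980, Base change for GL(2) §7; ArthurClozel1989 Ch. 1;
Bump1997 §4.?] -/
def IsUnfoldingDiscriminant (D : ℕ) : Prop :=
  1 < D ∧ Squarefree D ∧ jacobiSym (D : ℤ) 3 ≠ 1

/-- Example: `D = 5` unfolds (`5 ≡ 2 mod 3`, `3` inert in `ℚ(√5)`). -/
theorem isUnfoldingDiscriminant_five : IsUnfoldingDiscriminant 5 := by
  refine ⟨by norm_num, Nat.prime_five.prime.squarefree, ?_⟩
  norm_num

/-- Example: `D = 6` unfolds (`3` ramified in `ℚ(√6)`). -/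
theorem isUnfoldingDiscriminant_six : IsUnfoldingDiscriminant 6 := by
  refine ⟨by norm_num, ?_, ?_⟩
  · rw [show (6 : ℕ) = 2 * 3 from rfl]
    exact (Nat.squarefree_mul (by norm_num)).mpr ⟨Nat.prime_two.prime.squarefree, Nat.prime_three.prime.squarefree⟩
  · norm_num

/-! ## §1 Pieces (Props) — the wall frame verbatim, then the partner -/

/-- PIECE A (UNDECIDED) — **product μ-dominance for the pair `(E, E^D)` on the `K`-line.** At every wall frame of
`W` (binders = the wall's, verbatim), every generator `g` of `Ch_Λ(X_(∅,0)(E/K_∞))·R₀⟦T⟧`, every unfolding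
discriminant `D`, every modular parametrisation `Dt₂` of the twist model `W^D = W.quadraticTwist D` of level `N₂`
satisfying the Heegner hypothesis for `K`, every BDP branch `L₂` of `Dt₂.f` at the SAME `(ι', 𝔭, κ, γ)` and every
generator `g₂` of `Ch_Λ(X_(∅,0)(E^D/K_∞))·R₀⟦T⟧`: each power of `3` dividing `g·g₂` divides `L·L₂`
(`μ(g) + μ(g₂) ≤ μ(L) + μ(L₂)`). PRODUCER (informal, the point of the node): the two-variable `(∅,0)` main
conjecture inclusion for `BC_F(f_E)` over the CM quartic field `KF` (where `v ∣ 3` is UNFOLDED and split in `KF/F`),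
specialised `Gal(KF/K)`-equivariantly to the `K`-line `Γ_K ⊂ Γ^{ac}_{KF} ≅ ℤ₃²`, where every `KF`-object is the
`E ⊕ E^D` object over `K_∞` (restriction `2 ∤ 3` is lossless) and Hsieh's two-variable `𝒫_Σ(π_F, 𝟙)` restricts
to `L·L₂·(unit)` (Artin formalism by interpolation). [Hsieh2014 DocMath 19 Thm 1 (arXiv:1112.1580 p.4);
Washington1997 §13.2; CastellaWan ±-BDP shape] -/
def TwinProductMuDominanceAtThree : Prop :=
  ∀ (W : WeierstrassCurve ℚ) [W.IsElliptic] [W.IsGloballyMinimal] (N : ℕ) [NeZero N] (K : Type) [Field K]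
    [NumberField K] (Dt : ModularForms.ModularParametrizationData W N),
    Summit.BirchSwinnertonDyer.Rank1Residual.Additive.ClassO6 W 3 → W.HasSurjectiveModNGaloisRep 3 →
    W.analyticRank = 1 → W.conductorNorm ℤ = N → IsImaginaryQuadratic K → SatisfiesHeegnerHypothesis N K →
    ∀ (κ : ZpExtension K 3), κ.IsAnticyclotomic →
    ∀ (γ : Field.absoluteGaloisGroup K) [Fact (κ.IsTopGenerator γ)]
      (𝔭 : IsDedekindDomain.HeightOneSpectrum (NumberField.RingOfIntegers K)),
      ((3 : ℕ) : NumberField.RingOfIntegers K) ∈ 𝔭.asIdeal →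
      𝔭.asIdeal.ramificationIdx (NumberField.RingOfIntegers ℚ) = 1 →
      𝔭.asIdeal.inertiaDeg (NumberField.RingOfIntegers ℚ) = 1 →
      ∀ (𝔭' : IsDedekindDomain.HeightOneSpectrum (NumberField.RingOfIntegers K)),
        ((3 : ℕ) : NumberField.RingOfIntegers K) ∈ 𝔭'.asIdeal → 𝔭' ≠ 𝔭 →
        ∀ (ι' : PadicAlgCl 3 ≃+* ℂ),
          Summit.BirchSwinnertonDyer.BirchSwinnertonDyer.Theorems.SchneiderFree.BranchInducesPrime 3 ι' 𝔭 →
          ∀ (ΩK : ℂ) (Ωp : ℂ_[3]) (L : UnrSeries 3), ΩK ≠ 0 → Ωp ≠ 0 →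
            IsBDPLFunction ι' 𝔭 κ γ Dt.f ΩK Ωp L →
            ∀ g : UnrSeries 3,
              (AcSelmer.XAc.charIdeal (W.baseChange K) 3 κ 𝔭' ∅ γ).map (PowerSeries.map (Halves.toUnr 3)) =
                  Ideal.span {g} →
              -- the partner `E^D`
              ∀ (D : ℕ), IsUnfoldingDiscriminant D →
              ∀ (N₂ : ℕ) [NeZero N₂] [(W.quadraticTwist (D : ℚ)).IsElliptic]
                (Dt₂ : ModularForms.ModularParametrizationData (W.quadraticTwist (D : ℚ)) N₂),
                SatisfiesHeegnerHypothesis N₂ K →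
                ∀ (ΩK₂ : ℂ) (Ωp₂ : ℂ_[3]) (L₂ : UnrSeries 3), ΩK₂ ≠ 0 → Ωp₂ ≠ 0 →
                  IsBDPLFunction ι' 𝔭 κ γ Dt₂.f ΩK₂ Ωp₂ L₂ →
                  ∀ g₂ : UnrSeries 3,
                    (AcSelmer.XAc.charIdeal ((W.quadraticTwist (D : ℚ)).baseChange K) 3 κ 𝔭' ∅ γ).map
                        (PowerSeries.map (Halves.toUnr 3)) = Ideal.span {g₂} →
                    ∀ j : ℕ, (PowerSeries.C ((3 : ℕ) : unrIntegers 3)) ^ j ∣ g * g₂ →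
                      (PowerSeries.C ((3 : ℕ) : unrIntegers 3)) ^ j ∣ L * L₂

/-- PIECE B (UNDECIDED / ATTACKABLE literature port) — **some unfolding twist has a BDP branch of `μ`-invariant
zero.** At every wall frame of `W`: there is an unfolding discriminant `D`, a level `N₂` satisfying the Heegner
hypothesis for `K`, a modular parametrisation `Dt₂` of the twist model `W^D` (modularity of `E^D`, level
`N₂ = N·D²` when `gcd(D, 2N) = 1`), admissible periods and a BDP branch `L₂` of `Dt₂.f` at the SAME
`(ι', 𝔭, κ, γ)` with `3 ∤ L₂` in `R₀⟦T⟧`, i.e. `μ(L₂) = 0`. Hsieh's theorem (F = ℚ, λ = 𝟙, Σ = {𝔭}; hypotheses: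
`ρ̄_{E^D,3}|_{G_K}` irreducible — automatic from surjectivity since `3` splits in `K`; `𝔫⁻ = 1` by Heegner; the
one check is that his construction/μ-argument tolerates the additive level `3² ∣ N D²`, "𝔑 = prime-to-p
conductor"). `D` chosen with every prime `q ∣ D` split in `K` and `gcd(D, 6N) = 1` (Dirichlet/Chebotarev supply).
[Hsieh2014 DocMath 19 Thm 2 = Thm B (arXiv:1112.1580 p.4); Vatsal2003 Duke 116 (μ of definite theta); BDP2013] -/
def TwinAnalyticMuZeroAtThree : Prop :=
  ∀ (W : WeierstrassCurve ℚ) [W.IsElliptic] [W.IsGloballyMinimal] (N : ℕ) [NeZero N] (K : Type) [Field K]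
    [NumberField K] (Dt : ModularForms.ModularParametrizationData W N),
    Summit.BirchSwinnertonDyer.Rank1Residual.Additive.ClassO6 W 3 → W.HasSurjectiveModNGaloisRep 3 →
    W.analyticRank = 1 → W.conductorNorm ℤ = N → IsImaginaryQuadratic K → SatisfiesHeegnerHypothesis N K →
    ∀ (κ : ZpExtension K 3), κ.IsAnticyclotomic →
    ∀ (γ : Field.absoluteGaloisGroup K) [Fact (κ.IsTopGenerator γ)]
      (𝔭 : IsDedekindDomain.HeightOneSpectrum (NumberField.RingOfIntegers K)),
      ((3 : ℕ) : NumberField.RingOfIntegers K) ∈ 𝔭.asIdeal →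
      𝔭.asIdeal.ramificationIdx (NumberField.RingOfIntegers ℚ) = 1 →
      𝔭.asIdeal.inertiaDeg (NumberField.RingOfIntegers ℚ) = 1 →
      ∀ (𝔭' : IsDedekindDomain.HeightOneSpectrum (NumberField.RingOfIntegers K)),
        ((3 : ℕ) : NumberField.RingOfIntegers K) ∈ 𝔭'.asIdeal → 𝔭' ≠ 𝔭 →
        ∀ (ι' : PadicAlgCl 3 ≃+* ℂ),
          Summit.BirchSwinnertonDyer.BirchSwinnertonDyer.Theorems.SchneiderFree.BranchInducesPrime 3 ι' 𝔭 →
          ∀ (ΩK : ℂ) (Ωp : ℂ_[3]) (L : UnrSeries 3), ΩK ≠ 0 → Ωp ≠ 0 →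
            IsBDPLFunction ι' 𝔭 κ γ Dt.f ΩK Ωp L →
            ∃ (D : ℕ) (_ : IsUnfoldingDiscriminant D) (N₂ : ℕ) (_ : NeZero N₂)
              (_ : (W.quadraticTwist (D : ℚ)).IsElliptic)
              (Dt₂ : ModularForms.ModularParametrizationData (W.quadraticTwist (D : ℚ)) N₂)
              (_ : SatisfiesHeegnerHypothesis N₂ K) (ΩK₂ : ℂ) (Ωp₂ : ℂ_[3]) (L₂ : UnrSeries 3),
              ΩK₂ ≠ 0 ∧ Ωp₂ ≠ 0 ∧ IsBDPLFunction ι' 𝔭 κ γ Dt₂.f ΩK₂ Ωp₂ L₂ ∧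
                ¬ (PowerSeries.C ((3 : ℕ) : unrIntegers 3) : UnrSeries 3) ∣ L₂

/-! ## §2 Registered stubs (the ONLY `sorry`s) -/

/-- STUB (WEAKER — route item 24207 `RationalSplitIMCInclusionAtThree` BY NAME; landed `ratwall_of_wall`). -/
theorem stub_ratwall : RationalSplitIMCInclusionAtThree := by
  sorry

/-- STUB (UNDECIDED — piece A, the product μ-dominance on the `K`-line; producer = two-variable theory over the
unfolding field `KF`, leaves A1–A4 of the card). -/
theorem stub_twinProductMuDominance : TwinProductMuDominanceAtThree := by
  sorry

/-- STUB (UNDECIDED/ATTACKABLE — piece B, Hsieh-type analytic `μ = 0` for one unfolding twist). -/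
theorem stub_twinAnalyticMuZero : TwinAnalyticMuZeroAtThree := by
  sorry

/-! ## §3 Kernel: the partner cancels (no `sorry`) -/

/-- **Partner cancellation in `R₀⟦T⟧`.** If every power of the prime `3` dividing `g·g₂` divides `L·L₂`, and
`3 ∤ L₂`, then every power of `3` dividing `g` divides `L`: `3^j ∣ g ⇒ 3^j ∣ g g₂ ⇒ 3^j ∣ L L₂ ⇒ 3^j ∣ L`
(`Prime.pow_dvd_of_dvd_mul_right`). [folklore; Washington1997 §7.1] -/
theorem pow_dvd_of_partner {g g₂ L L₂ : UnrSeries 3}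
    (hprod : ∀ j : ℕ, (PowerSeries.C ((3 : ℕ) : unrIntegers 3)) ^ j ∣ g * g₂ →
      (PowerSeries.C ((3 : ℕ) : unrIntegers 3)) ^ j ∣ L * L₂)
    (hμ₂ : ¬ (PowerSeries.C ((3 : ℕ) : unrIntegers 3) : UnrSeries 3) ∣ L₂)
    (j : ℕ) (hj : (PowerSeries.C ((3 : ℕ) : unrIntegers 3)) ^ j ∣ g) :
    (PowerSeries.C ((3 : ℕ) : unrIntegers 3)) ^ j ∣ L :=
  prime_C_three.pow_dvd_of_dvd_mul_right j hμ₂ (hprod j (dvd_mul_of_dvd_left hj g₂))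

/-- **μ-dominance for `E` from the pair.** At a frame: piece B supplies the partner `(D, N₂, Dt₂, Ω's, L₂)` with
`3 ∤ L₂`; `Ch_Λ(X_(∅,0)(E^D/K_∞))·R₀⟦T⟧ = (g₂)` for some `g₂` (always, `exists_map_charIdeal_eq_span`); piece A
gives the product dominance; `pow_dvd_of_partner` cancels the partner. [folklore] -/
theorem muDominance_of_partner :
    TwinProductMuDominanceAtThree → TwinAnalyticMuZeroAtThree → MuDominanceAtThree := by
  intro hA hB W _ _ N _ K _ _ Dt hO6 hsurj hr1 hN hK hH κ hκ γ _ 𝔭 h3 he hf 𝔭' h3' hne ι' hι ΩK Ωp L hΩK hΩp hL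
    g hg j hj
  obtain ⟨D, hD, N₂, _, _, Dt₂, hH₂, ΩK₂, Ωp₂, L₂, hΩK₂, hΩp₂, hL₂, hμ₂⟩ :=
    hB W N K Dt hO6 hsurj hr1 hN hK hH κ hκ γ 𝔭 h3 he hf 𝔭' h3' hne ι' hι ΩK Ωp L hΩK hΩp hL
  obtain ⟨g₂, hg₂⟩ :=
    exists_map_charIdeal_eq_span (AcSelmer.XAc ((W.quadraticTwist (D : ℚ)).baseChange K) 3 κ 𝔭' ∅ γ)
  have hg₂' : (AcSelmer.XAc.charIdeal ((W.quadraticTwist (D : ℚ)).baseChange K) 3 κ 𝔭' ∅ γ).map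
      (PowerSeries.map (Halves.toUnr 3)) = Ideal.span {g₂} := hg₂
  have hprod := hA W N K Dt hO6 hsurj hr1 hN hK hH κ hκ γ 𝔭 h3 he hf 𝔭' h3' hne ι' hι ΩK Ωp L hΩK hΩp hL g hg
    D hD N₂ Dt₂ hH₂ ΩK₂ Ωp₂ L₂ hΩK₂ hΩp₂ hL₂ g₂ hg₂'
  exact pow_dvd_of_partner hprod hμ₂ j hj

/-! ## §4 The crux BY NAME -/

/-- **THE WALL from RATWALL and the unfolded partner.** RATWALL (24207) and μ-dominance are jointly the wall
(g7 door `wall_iff_ratwall_and_muDominance`); μ-dominance comes from the pair `(E, E^D)` by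
`muDominance_of_partner`. Concludes `AdditiveSplitIMCInclusionAtThree` BY NAME. -/
theorem AdditiveSplitIMCInclusionAtThree_of :
    RationalSplitIMCInclusionAtThree → TwinProductMuDominanceAtThree → TwinAnalyticMuZeroAtThree →
      AdditiveSplitIMCInclusionAtThree :=
  fun hR hA hB ↦ wall_of_ratwall_of_muDominance hR (muDominance_of_partner hA hB)

/-- The node assembled from its registered stubs (sanity: the composition typechecks end to end). -/
theorem additiveSplitIMCInclusionAtThree_of_stubs : AdditiveSplitIMCInclusionAtThree :=
  AdditiveSplitIMCInclusionAtThree_of stub_ratwall stub_twinProductMuDominance stub_twinAnalyticMuZero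

/-! ## §5 Tag evidence (no `sorry`) -/

/-- Tag WEAKER for `stub_ratwall`: THE WALL ⟹ RATWALL (landed). -/
theorem ratwall_of_wall' : AdditiveSplitIMCInclusionAtThree → RationalSplitIMCInclusionAtThree :=
  rationalSplitIMCInclusionAtThree_of_wall

/-- Tag evidence for pieces A ∧ B jointly: they give exactly the wall's surplus over 24207 (`MuDominanceAtThree`,
g7 `muDominance_of_wall`), hence A ∧ B ∧ RATWALL ⟺-sandwich: WALL ⟹ μ-dominance ⟸ A ∧ B. Neither A nor B alone
is comparable with the crux as typed (A speaks about `E^D` too; B is an analytic `μ = 0`). -/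
theorem muDominance_iff_side : (TwinProductMuDominanceAtThree ∧ TwinAnalyticMuZeroAtThree) →
    (AdditiveSplitIMCInclusionAtThree ↔ RationalSplitIMCInclusionAtThree) := by
  rintro ⟨hA, hB⟩
  exact ⟨rationalSplitIMCInclusionAtThree_of_wall, fun hR ↦ AdditiveSplitIMCInclusionAtThree_of hR hA hB⟩

end Summit.BirchSwinnertonDyer.BirchSwinnertonDyer.Cruxes.AdditiveSplitIMCInclusionAtThree.QuadraticUnfoldingPartner

end
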